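import Mathlib
import Literature.Barriers.ValiantsHypothesis.AlgebraicNaturalProofs
import Literature.Computability.AlgebraicComplexity.ArithCircuitProofs
import Summits.ValiantsHypothesis.ValiantsHypothesis.Theorems.BarrierLeverSuccinctHittingSetsForVPLowDegree
import Summits.ValiantsHypothesis.ValiantsHypothesis.Theorems.BarrierLeverSuccinctHittingSetsForVPLowSupport
import HarnessLib

/-!
# Crux `BarrierLever.SuccinctHittingSetsForVP` (stmt-ValiantsHypothesis-14610), line `registered` —
EQUATIONS VANISH TO HIGH ORDER ALONG SMALLER CIRCUITS (Taylor shifts of an equation are wide)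

**What is proved (unconditional; structure of the open stub `stub_levelOne`, it does NOT close the
item).** Let `D` be an equation of `SmallCircuits ℂ n b` (a polynomial in the `C(2n,n)` coefficient
variables vanishing at `coeff(f)` for every `f` of degree `≤ n` and size `≤ n^b`), and let `f₀` be
a SMALLER circuit, `f₀ ∈ SmallCircuits ℂ n b'` with `n^b' + t(2n+2) + 1 ≤ n^b`. Then the Taylor
shift `D(coeff f₀ + w)` of `D` to the point `coeff f₀` — formally
`aeval (fun m => C (coeff m f₀) + X m) D` — has NO monomial in `w` with `≤ t` distinct variables
(`card_support_gt_of_shift`, registered stub `stub_equations_vanish_to_high_order`). In particular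
(`t ≥ 1`) its constant and linear parts vanish: `D(coeff f₀) = 0` and every first-order partial
derivative `∂D/∂c_m` vanishes at `coeff f₀` (`coeff_single_shift_eq_zero`) — an equation of
size-`n^b` circuits is SINGULAR at every coefficient vector of a size-`n^b'` circuit, and more
generally vanishes there to order `> t` in every `t`-subset of coordinate directions.

Reason: `f₀ + Σ_{μ ∈ S} w_μ x^μ` is again a small circuit (`L ≤ n^b' + |S|(2n+2) + 1 ≤ n^b`) whose
coefficient vector is `coeff f₀ + w`; so `D(coeff f₀ + ·)` vanishes on all `t`-sparse vectors, and a
polynomial with a monomial of support `≤ t` does not (`LowSupport.exists_eval_ne_zero_supported`).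
Axioms: `propext`, `Classical.choice`, `Quot.sound`. References: [ForbesShpilkaVolk2018] Def. 1,
Question 6 (framework); the observation is folklore (closure of the class under sparse shifts).
-/

-- layout Summits/ValiantsHypothesis/ValiantsHypothesis forces the duplicated namespace component
set_option linter.dupNamespace false

namespace Summit.ValiantsHypothesis.ValiantsHypothesis.Theorems.BarrierLever.SuccinctHittingSetsForVP

open Literature.Barriers.ValiantsHypothesis Literature.Computability.AlgebraicComplexity MvPolynomial

namespace ShiftedSupport

variable {ι : Type*}

/-- Evaluating the Taylor shift: `(D(a + X))(w) = D(a + w)`. [folklore] -/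
theorem eval_shift (a w : ι → ℂ) (D : MvPolynomial ι ℂ) :
    eval w (aeval (fun i => C (a i) + X i) D) = eval (fun i => a i + w i) D := by
  have key : (eval w).comp (aeval (fun i => C (a i) + X i) :
        MvPolynomial ι ℂ →ₐ[ℂ] MvPolynomial ι ℂ).toRingHom = eval (fun i => a i + w i) :=
    MvPolynomial.ringHom_ext (fun c => by simp) (fun i => by simp)
  exact RingHom.congr_fun key D

variable {n : ℕ}

/-- Adding a sparse correction to a small circuit: `f₀ + Σ_{μ ∈ S} w_μ x^μ` has degree `≤ n`,
size `≤ L(f₀) + |S|(2n+2) + 1`, and coefficient vector `coeff f₀ + w` (for `w` vanishing off `S`).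
[cite: Burgisser2000, §2.1] -/
theorem shift_mem_smallCircuits {b b' t : ℕ} (h : n ^ b' + t * (2 * n + 2) + 1 ≤ n ^ b)
    {f₀ : MvPolynomial (Fin n) ℂ} (hf₀ : f₀ ∈ SmallCircuits ℂ n b')
    (S : Finset (degLEMonomials n)) (hS : S.card ≤ t) (w : degLEMonomials n → ℂ) :
    f₀ + ∑ μ ∈ S, monomial (μ : Fin n →₀ ℕ) (w μ) ∈ SmallCircuits ℂ n b := by
  refine ⟨(totalDegree_add _ _).trans (max_le hf₀.1 (LowDegree.totalDegree_sparse_le S w)), ?_⟩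
  calc complexity (f₀ + ∑ μ ∈ S, monomial (μ : Fin n →₀ ℕ) (w μ))
      ≤ complexity f₀ + complexity (∑ μ ∈ S, (monomial (μ : Fin n →₀ ℕ) (w μ) :
          MvPolynomial (Fin n) ℂ)) + 1 := complexity_add_le_holds _ _
    _ ≤ n ^ b' + S.card * (2 * n + 2) + 1 := by
        gcongr
        · exact hf₀.2
        · exact LowDegree.complexity_sparse_le S w
    _ ≤ n ^ b' + t * (2 * n + 2) + 1 := by gcongr
    _ ≤ n ^ b := h

/-- Its coefficient vector is `coeff f₀ + w`. [folklore] -/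
theorem coeffVector_shift (f₀ : MvPolynomial (Fin n) ℂ) (S : Finset (degLEMonomials n))
    {w : degLEMonomials n → ℂ} (hw : ∀ μ, μ ∉ S → w μ = 0) :
    coeffVector (degLEMonomials n) (f₀ + ∑ μ ∈ S, monomial (μ : Fin n →₀ ℕ) (w μ)) =
      fun m : degLEMonomials n => coeff (m : Fin n →₀ ℕ) f₀ + w m := by
  funext m
  have h := congrFun (LowDegree.coeffVector_sparse S hw) m
  rw [coeffVector_apply] at h ⊢
  rw [coeff_add, h]

end ShiftedSupport

open ShiftedSupport

/-- **Taylor shifts of an equation along smaller circuits are wide.** If `D` vanishes at the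
coefficient vector of every `f ∈ SmallCircuits ℂ n b`, and `f₀ ∈ SmallCircuits ℂ n b'` with
`n^b' + t(2n+2) + 1 ≤ n^b`, then every monomial of the shifted polynomial `D(coeff f₀ + w)` has more
than `t` distinct variables. [cite: ForbesShpilkaVolk2018, Def. 1 and Question 6] -/
theorem card_support_gt_of_shift {n b b' t : ℕ} (h : n ^ b' + t * (2 * n + 2) + 1 ≤ n ^ b)
    {D : MvPolynomial (degLEMonomials n) ℂ}
    (hvan : ∀ f ∈ SmallCircuits ℂ n b, eval (coeffVector (degLEMonomials n) f) D = 0)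
    {f₀ : MvPolynomial (Fin n) ℂ} (hf₀ : f₀ ∈ SmallCircuits ℂ n b')
    {m₀ : (degLEMonomials n) →₀ ℕ}
    (hm₀ : m₀ ∈ (aeval (fun m : degLEMonomials n => C (coeff (m : Fin n →₀ ℕ) f₀) + X m) D).support) :
    t < m₀.support.card := by
  classical
  by_contra hle
  push Not at hle
  obtain ⟨w, hw, hne⟩ := LowSupport.exists_eval_ne_zero_supported hm₀
  rw [eval_shift] at hne
  have hmem := shift_mem_smallCircuits h hf₀ m₀.support hle w
  have := hvan _ hmem
  rw [coeffVector_shift f₀ m₀.support hw] at this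
  exact hne this

/-- **Equations are singular along smaller circuits.** Under the same hypotheses with `t ≥ 1`:
the shifted polynomial has zero constant term (`D(coeff f₀) = 0`) and zero linear part — the
coefficient of `w_m`, i.e. the partial derivative `∂D/∂c_m` at `coeff f₀`, vanishes for every `m`.
[cite: ForbesShpilkaVolk2018, Def. 1] -/
theorem coeff_single_shift_eq_zero {n b b' t : ℕ} (ht : 1 ≤ t)
    (h : n ^ b' + t * (2 * n + 2) + 1 ≤ n ^ b) {D : MvPolynomial (degLEMonomials n) ℂ}
    (hvan : ∀ f ∈ SmallCircuits ℂ n b, eval (coeffVector (degLEMonomials n) f) D = 0)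
    {f₀ : MvPolynomial (Fin n) ℂ} (hf₀ : f₀ ∈ SmallCircuits ℂ n b') (m : degLEMonomials n) :
    coeff (Finsupp.single m 1)
        (aeval (fun m : degLEMonomials n => C (coeff (m : Fin n →₀ ℕ) f₀) + X m) D) = 0 ∧
      coeff 0 (aeval (fun m : degLEMonomials n => C (coeff (m : Fin n →₀ ℕ) f₀) + X m) D) = 0 := by
  classical
  constructor
  · by_contra hne
    have hlt := card_support_gt_of_shift h hvan hf₀ (mem_support_iff.mpr hne)
    rw [Finsupp.support_single _ one_ne_zero, Finset.card_singleton] at hlt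
    omega
  · by_contra hne
    have hlt := card_support_gt_of_shift h hvan hf₀ (mem_support_iff.mpr hne)
    rw [Finsupp.support_zero, Finset.card_empty] at hlt
    omega

/-- **Registered stub `stub_equations_vanish_to_high_order`** (crux stmt-ValiantsHypothesis-14610,
line `registered`; STRUCTURE of the open stub `stub_levelOne`): an equation of the size-`n^b`
circuits, Taylor-shifted to the coefficient vector of any size-`n^b'` circuit with
`n^b' + t(2n+2) + 1 ≤ n^b`, has no monomial of support `≤ t` — equations for `VP_n(n^b)` vanish to
order `> t` along `VP_n(n^b')` in every `t` coordinate directions. [cite: ForbesShpilkaVolk2018, Def. 1] -/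
theorem stub_equations_vanish_to_high_order :
    ∀ n b b' t : ℕ, n ^ b' + t * (2 * n + 2) + 1 ≤ n ^ b →
      ∀ D : MvPolynomial (degLEMonomials n) ℂ,
        (∀ f ∈ SmallCircuits ℂ n b, MvPolynomial.eval (coeffVector (degLEMonomials n) f) D = 0) →
        ∀ f₀ ∈ SmallCircuits ℂ n b', ∀ m₀ ∈ (MvPolynomial.aeval
          (fun m : degLEMonomials n => MvPolynomial.C (MvPolynomial.coeff (m : Fin n →₀ ℕ) f₀) +
            MvPolynomial.X m) D).support, t < m₀.support.card :=
  fun _ _ _ _ h _ hvan _ hf₀ _ hm₀ => card_support_gt_of_shift h hvan hf₀ hm₀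

end Summit.ValiantsHypothesis.ValiantsHypothesis.Theorems.BarrierLever.SuccinctHittingSetsForVP
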